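import Mathlib
import Summits.MatrixMultiplication.MatrixMultiplication.Theses.AutomaticSTPPDesigns
import Summits.MatrixMultiplication.MatrixMultiplication.Theorems.AutomaticSTPPDesignsBlockTensorTransfer
import Summits.MatrixMultiplication.MatrixMultiplication.Theorems.AutomaticSTPPDesignsAutomaticPackingThesisStubConcatSTPP
import Summits.MatrixMultiplication.MatrixMultiplication.Theorems.AutomaticSTPPDesignsAutomaticPackingThesisCyclicCalibration
import Literature.Combinatorics.Additive.TripleProductProperty
import Literature.Computability.AlgebraicComplexity.GroupTheoreticMatMul
import Literature.Computability.AutomaticStructures.AutomaticBlock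

/-!
# `AutomaticPackingThesis` — the finite cyclic normal form (crux ⟺ one finite design per exponent)

Route `MatrixMultiplication/AutomaticSTPPDesigns`, crux `stmt-MatrixMultiplication-7356`
(`AutomaticPackingThesis`), line `Sketch` (crux ideas `concatenation-monoid-normal-form`,
`cyclic-ratio-normal-form`). Support file (`--supports`): it does not close the crux, it pins down
exactly what the crux IS.

The crux asks for ONE base `p ≥ 2` such that for EVERY `ε > 0` three regular languages give an
all-scales STPP block family in the `ℤ/(p^k)` tower beating `p^k` at exponent `(2+ε)/3` at
infinitely many scales. This file proves that the automaton / all-scales / one-base / infinitely-often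
clauses carry no content beyond a single finite object per exponent:

  `CyclicBeat : ∀ τ > 2/3, ∃ p ≥ 2, K, n, (Aᵢ, Bᵢ, Cᵢ)_{i<n}` STPP in `ℤ/(p^K)` with
  `p^K < ∑ᵢ (|Aᵢ||Bᵢ||Cᵢ|)^τ`

(`K = 1` is allowed, so the modulus is in effect an arbitrary `N ≥ 2`; see
`automaticPackingThesis_iff_anyModulus`).

* `concatPower` — concatenation powers (from the landed `stub_concatSTPP`, CKSU 2005 Lemma 5.4 read
  inside ONE cyclic `p`-tower): an STPP design in `ℤ/(p^K)` has, for every `m`, an STPP design in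
  `ℤ/(p^(K m))` whose packing sum at any exponent is the `m`-th power of the original one — so a
  packing RATIO `> 1` becomes `> 6`.
* `automaticPackingThesis_of_cyclicBeat` — `CyclicBeat →` crux, with base `2`: ratio `> 6 = 3·2`
  feeds the route's proved calibration lemma `BlockTensorTransfer` (`blockTensorTransfer_proof`).
* `cyclicBeat_of_automaticPackingThesis` — crux `→ CyclicBeat`: a beating scale `k` at
  `ε = 3τ - 2` is a finite design in `ℤ/(p^k)` (reindexed along `Fintype.equivFin`).
* `automaticPackingThesis_iff_cyclicBeat` — the equivalence.
* `automaticPackingThesis_iff_anyModulus` — the same with an arbitrary modulus `N ≥ 2` in place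
  of `p^K`.
* `not_automaticPackingThesis_iff_uniformGap` — the refutation normal form: the crux FAILS iff some
  exponent `τ₀ > 2/3` is a uniform packing ceiling, `∑ᵢ (|Aᵢ||Bᵢ||Cᵢ|)^τ₀ ≤ N` for every STPP design
  in every cyclic `ℤ/N`, `N ≥ 2`.

## References

* H. Cohn, R. Kleinberg, B. Szegedy, C. Umans, *Group-theoretic algorithms for matrix
  multiplication*, FOCS 2005, arXiv:math/0511460: Def. 5.1 (STPP), Lemma 5.4, Thm. 5.5.
* J. Blasiak, H. Cohn, J. A. Grochow, K. Pratt, C. Umans, *Matrix multiplication via matrix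
  groups*, ITCS 2023, arXiv:2204.03826, p. 3 (no family of abelian groups is known to meet the
  packing bound; cyclic / unbounded-exponent hosts are the open regime after BCCGNSU 2017 Thm. B).
-/

-- single-conjunct summit: the mandated namespace repeats `MatrixMultiplication`.
set_option linter.dupNamespace false

noncomputable section

namespace Summit.MatrixMultiplication.MatrixMultiplication.Theorems

namespace AutomaticPackingThesis

open Finset Literature.Combinatorics.Additive Literature.Computability.AlgebraicComplexity
  Literature.Computability.AutomaticStructures
open Summit.MatrixMultiplication.MatrixMultiplication.Theses.AutomaticSTPPDesigns

/-! ### Concatenation powers -/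

/-- **Concatenation powers** (CKSU 2005 Lemma 5.4 inside one cyclic `p`-tower, via
`stub_concatSTPP`): an STPP design in `ℤ/(p^K)` indexed by `Fin n` has, for every `m`, an `m`-th
concatenation power — an STPP design in `ℤ/(p^(K m))` whose packing sum at any real exponent `τ` is
the `m`-th power of the original one. [folklore] -/
theorem concatPower (p K : ℕ) (hp : 0 < p) (n : ℕ) (A B C : Fin n → Finset (ZMod (p ^ K)))
    (hS : IsSTPP A B C) (τ : ℝ) :
    ∀ m : ℕ, ∃ (nm : ℕ) (Am Bm Cm : Fin nm → Finset (ZMod (p ^ (K * m)))), IsSTPP Am Bm Cm ∧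
      ∑ i, (((Am i).card * (Bm i).card * (Cm i).card : ℕ) : ℝ) ^ τ =
        (∑ i, (((A i).card * (B i).card * (C i).card : ℕ) : ℝ) ^ τ) ^ m := by
  intro m
  induction m with
  | zero =>
    refine ⟨1, fun _ => {0}, fun _ => {0}, fun _ => {0}, ?_, ?_⟩
    · intro i j k s hs s' hs' t ht t' ht' u hu u' hu' _
      simp only [Finset.mem_singleton] at hs hs' ht ht' hu hu'
      exact ⟨Subsingleton.elim _ _, Subsingleton.elim _ _, by rw [hs, hs'], by rw [ht, ht'],
        by rw [hu, hu']⟩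
    · rw [pow_zero, Fin.sum_univ_one, Finset.card_singleton]
      simp only [Nat.cast_one, mul_one, Real.one_rpow]
  | succ m ih =>
    obtain ⟨nm, Am, Bm, Cm, hSm, hsum⟩ := ih
    -- concatenate the `m`-th power (low digits) with the design itself (high digits)
    have hcat := stub_concatSTPP p (K * m) K hp (Fin nm) (Fin n) Am Bm Cm A B C
      ((isSTPP_iff_addSimultaneousTPP _ _ _).1 hSm) ((isSTPP_iff_addSimultaneousTPP _ _ _).1 hS)
    set e : Fin (nm * n) ≃ Fin nm × Fin n := finProdFinEquiv.symm with he
    set A' : Fin nm × Fin n → Finset (ZMod (p ^ (K * m + K))) := fun i =>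
      (Am i.1 ×ˢ A i.2).image fun x => ((x.1.val + p ^ (K * m) * x.2.val : ℕ) : ZMod (p ^ (K * m + K)))
      with hA'
    set B' : Fin nm × Fin n → Finset (ZMod (p ^ (K * m + K))) := fun i =>
      (Bm i.1 ×ˢ B i.2).image fun x => ((x.1.val + p ^ (K * m) * x.2.val : ℕ) : ZMod (p ^ (K * m + K)))
      with hB'
    set C' : Fin nm × Fin n → Finset (ZMod (p ^ (K * m + K))) := fun i =>
      (Cm i.1 ×ˢ C i.2).image fun x => ((x.1.val + p ^ (K * m) * x.2.val : ℕ) : ZMod (p ^ (K * m + K)))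
      with hC'
    have hcat' : IsSTPP (A' ∘ e) (B' ∘ e) (C' ∘ e) :=
      (isSTPP_iff_addSimultaneousTPP _ _ _).2 (hcat.comp e.injective)
    refine ⟨nm * n, A' ∘ e, B' ∘ e, C' ∘ e, hcat', ?_⟩
    -- block sizes multiply, so the packing sum is the product of the two packing sums
    have hterm : ∀ i : Fin nm × Fin n,
        (((A' i).card * (B' i).card * (C' i).card : ℕ) : ℝ) ^ τ =
          (((Am i.1).card * (Bm i.1).card * (Cm i.1).card : ℕ) : ℝ) ^ τ *
            (((A i.2).card * (B i.2).card * (C i.2).card : ℕ) : ℝ) ^ τ := by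
      intro i
      rw [← Real.mul_rpow (Nat.cast_nonneg _) (Nat.cast_nonneg _)]
      congr 1
      simp only [hA', hB', hC', card_concat p (K * m) K hp]
      push_cast
      ring
    simp only [Function.comp_apply]
    rw [e.sum_comp (fun i => (((A' i).card * (B' i).card * (C' i).card : ℕ) : ℝ) ^ τ),
      Fintype.sum_prod_type]
    simp only [hterm]
    rw [← Finset.sum_mul_sum, hsum, pow_succ]

/-! ### The normal form -/

/-- **Finite cyclic designs give the crux** (composition of line `Sketch`): if for every `τ > 2/3`
some finite STPP design in some cyclic `p`-group `ℤ/(p^K)` (`p ≥ 2`) beats its host at exponent `τ`,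
then `AutomaticPackingThesis` holds, with base `2`. Given `ε > 0` put `τ = (2+ε)/3`; a witness with
ratio `r = ∑ᵢ xᵢ^τ / p^K > 1` has concatenation powers (`concatPower`) with ratio `r^m > 6`, i.e. a
finite cyclic STPP design with `∑ x^τ > 3·2·N`, `N = p^(K m)`, and the route's calibration lemma
`BlockTensorTransfer` (proved: `blockTensorTransfer_proof`) turns it into a regular all-scales family
in the `ℤ/(2^k)` tower beating `2^k` at exponent `τ` infinitely often. [folklore] -/
theorem automaticPackingThesis_of_cyclicBeat
    (h : ∀ τ : ℝ, 2 / 3 < τ →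
      ∃ (p K n : ℕ) (_ : 2 ≤ p) (A B C : Fin n → Finset (ZMod (p ^ K))),
        IsSTPP A B C ∧ (p : ℝ) ^ K < ∑ i, (((A i).card * (B i).card * (C i).card : ℕ) : ℝ) ^ τ) :
    AutomaticPackingThesis := by
  classical
  refine ⟨2, le_rfl, fun ε hε => ?_⟩
  have hτ : (2 : ℝ) / 3 < (2 + ε) / 3 := by linarith
  have hτ0 : (0 : ℝ) < (2 + ε) / 3 := by linarith
  obtain ⟨p, K, n, hp, A, B, C, hS, hbeat⟩ := h ((2 + ε) / 3) hτ
  set S : ℝ := ∑ i, (((A i).card * (B i).card * (C i).card : ℕ) : ℝ) ^ ((2 + ε) / 3) with hSdef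
  have hpK : (0 : ℝ) < (p : ℝ) ^ K := by positivity
  have hr : 1 < S / (p : ℝ) ^ K := by rwa [one_lt_div hpK]
  obtain ⟨m, hm⟩ := pow_unbounded_of_one_lt (6 : ℝ) hr
  obtain ⟨nm, Am, Bm, Cm, hSm, hsum⟩ := concatPower p K (by omega) n A B C hS ((2 + ε) / 3) m
  have h1N : 1 ≤ p ^ (K * m) := Nat.one_le_pow _ _ (by omega)
  have hbig : (3 * (2 : ℕ) * (p ^ (K * m) : ℕ) : ℝ) <
      ∑ i, (((Am i).card * (Bm i).card * (Cm i).card : ℕ) : ℝ) ^ ((2 + ε) / 3) := by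
    rw [hsum]
    have hSm' : S ^ m = (S / (p : ℝ) ^ K) ^ m * (p : ℝ) ^ (K * m) := by
      rw [div_pow, pow_mul, div_mul_cancel₀]
      exact pow_ne_zero _ (pow_ne_zero _ (by exact_mod_cast (by omega : p ≠ 0)))
    rw [hSm']
    have hpKm : (0 : ℝ) < (p : ℝ) ^ (K * m) := by positivity
    push_cast
    nlinarith
  obtain ⟨ι, instι, LA, LB, LC, hA, hB, hC, hfam⟩ :=
    blockTensorTransfer_proof (p ^ (K * m)) nm Am Bm Cm h1N hSm 2 le_rfl ((2 + ε) / 3) hτ0 hbig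
  exact ⟨ι, instι, LA, LB, LC, hA, hB, hC, hfam⟩

/-- **The crux gives finite cyclic designs** (converse): a beating level `k` of a witnessing tower
at `ε = 3τ - 2` is a finite STPP design in `ℤ/(p^k)` beating its host at exponent `τ` (reindexed
along `Fin n ≃ (Fin k → ι)`; the blocks are the tree's `automaticBlock`, defeq to the crux's inlined
`blk`). [folklore] -/
theorem cyclicBeat_of_automaticPackingThesis (h : AutomaticPackingThesis) :
    ∀ τ : ℝ, 2 / 3 < τ →
      ∃ (p K n : ℕ) (_ : 2 ≤ p) (A B C : Fin n → Finset (ZMod (p ^ K))),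
        IsSTPP A B C ∧ (p : ℝ) ^ K < ∑ i, (((A i).card * (B i).card * (C i).card : ℕ) : ℝ) ^ τ := by
  classical
  intro τ hτ
  obtain ⟨p, hp, h⟩ := h
  obtain ⟨ι, _, LA, LB, LC, -, -, -, hS, hbeat⟩ := h (3 * τ - 2) (by linarith)
  obtain ⟨k, -, hk⟩ := hbeat 0
  have hexp : (2 + (3 * τ - 2)) / 3 = τ := by ring
  rw [hexp] at hk
  set e : Fin (Fintype.card (Fin k → ι)) ≃ (Fin k → ι) := (Fintype.equivFin (Fin k → ι)).symm
    with he
  refine ⟨p, k, Fintype.card (Fin k → ι), hp, _, _, _,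
    (isSTPP_iff_addSimultaneousTPP _ _ _).2 ((hS k).comp e.injective), ?_⟩
  exact hk.trans_eq (e.sum_comp (fun w => (((automaticBlock p k LA w).card *
    (automaticBlock p k LB w).card * (automaticBlock p k LC w).card : ℕ) : ℝ) ^ τ)).symm

/-- **Normal form of the crux.** `AutomaticPackingThesis` holds iff for every `τ > 2/3` some finite
STPP design in some cyclic `p`-group `ℤ/(p^K)`, `p ≥ 2`, beats its host at exponent `τ`:
`p^K < ∑ᵢ (|Aᵢ||Bᵢ||Cᵢ|)^τ`. (The regular languages, the all-scales validity, the single base and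
the "infinitely many scales" of the crux are bookkeeping: concatenation powers + `BlockTensorTransfer`
one way, one beating level the other way.) [folklore] -/
theorem automaticPackingThesis_iff_cyclicBeat :
    AutomaticPackingThesis ↔
      ∀ τ : ℝ, 2 / 3 < τ →
        ∃ (p K n : ℕ) (_ : 2 ≤ p) (A B C : Fin n → Finset (ZMod (p ^ K))),
          IsSTPP A B C ∧ (p : ℝ) ^ K < ∑ i, (((A i).card * (B i).card * (C i).card : ℕ) : ℝ) ^ τ :=
  ⟨cyclicBeat_of_automaticPackingThesis, automaticPackingThesis_of_cyclicBeat⟩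

/-- In the trivial group `ZMod 1` no STPP family beats the host: at most one index has all three
blocks nonempty (the STPP relation holds trivially there), and its term is at most `1`. [folklore] -/
theorem sum_rpow_le_one_of_isSTPP_zmod_one {n : ℕ} (A B C : Fin n → Finset (ZMod 1))
    (hS : IsSTPP A B C) {τ : ℝ} (hτ : 0 < τ) :
    ∑ i, (((A i).card * (B i).card * (C i).card : ℕ) : ℝ) ^ τ ≤ 1 := by
  have hcard : ∀ (S : Finset (ZMod 1)), S.card ≤ 1 := fun S =>
    Finset.card_le_one.2 fun a _ b _ => Subsingleton.elim a b
  have hterm : ∀ i, (((A i).card * (B i).card * (C i).card : ℕ) : ℝ) ^ τ ≤ 1 := by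
    intro i
    have h1 : ((A i).card * (B i).card * (C i).card : ℕ) ≤ 1 := by
      calc (A i).card * (B i).card * (C i).card ≤ 1 * 1 * 1 :=
            Nat.mul_le_mul (Nat.mul_le_mul (hcard _) (hcard _)) (hcard _)
        _ = 1 := by norm_num
    exact Real.rpow_le_one (Nat.cast_nonneg _) (by exact_mod_cast h1) hτ.le
  have huniq : ∀ i j, ((A i).card * (B i).card * (C i).card : ℕ) ≠ 0 →
      ((A j).card * (B j).card * (C j).card : ℕ) ≠ 0 → i = j := by
    intro i j hi hj
    simp only [ne_eq, mul_eq_zero, Finset.card_eq_zero, not_or] at hi hj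
    obtain ⟨⟨hAi, hBi⟩, -⟩ := hi
    obtain ⟨⟨hAj, hBj⟩, hCj⟩ := hj
    obtain ⟨s', hs'⟩ := Finset.nonempty_iff_ne_empty.2 hAi
    obtain ⟨t, ht⟩ := Finset.nonempty_iff_ne_empty.2 hBi
    obtain ⟨s, hs⟩ := Finset.nonempty_iff_ne_empty.2 hAj
    obtain ⟨t', ht'⟩ := Finset.nonempty_iff_ne_empty.2 hBj
    obtain ⟨u, hu⟩ := Finset.nonempty_iff_ne_empty.2 hCj
    exact (hS i j j s hs s' hs' t ht t' ht' u hu u hu (Subsingleton.elim _ _)).1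
  by_cases hex : ∃ i, ((A i).card * (B i).card * (C i).card : ℕ) ≠ 0
  · obtain ⟨i₀, hi₀⟩ := hex
    rw [← Finset.sum_erase_add _ _ (Finset.mem_univ i₀)]
    have hrest : ∑ i ∈ Finset.univ.erase i₀,
        (((A i).card * (B i).card * (C i).card : ℕ) : ℝ) ^ τ = 0 := by
      refine Finset.sum_eq_zero fun i hi => ?_
      have hne : i ≠ i₀ := (Finset.mem_erase.1 hi).1
      have hz : ((A i).card * (B i).card * (C i).card : ℕ) = 0 := by
        by_contra hz
        exact hne (huniq i i₀ hz hi₀)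
      rw [hz, Nat.cast_zero, Real.zero_rpow hτ.ne']
    rw [hrest, zero_add]
    exact hterm i₀
  · push Not at hex
    calc ∑ i, (((A i).card * (B i).card * (C i).card : ℕ) : ℝ) ^ τ = 0 := by
          refine Finset.sum_eq_zero fun i _ => ?_
          rw [hex i, Nat.cast_zero, Real.zero_rpow hτ.ne']
      _ ≤ 1 := zero_le_one

/-- The same normal form with an ARBITRARY modulus: `AutomaticPackingThesis` holds iff for every
`τ > 2/3` some finite STPP design in some cyclic group `ℤ/N`, `N ≥ 2`, has
`N < ∑ᵢ (|Aᵢ||Bᵢ||Cᵢ|)^τ` (take `K = 1`, `p = N` one way; `N = p^K` the other way, where `K ≥ 1`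
because nothing beats the trivial group). [folklore] -/
theorem automaticPackingThesis_iff_anyModulus :
    AutomaticPackingThesis ↔
      ∀ τ : ℝ, 2 / 3 < τ →
        ∃ (N n : ℕ) (_ : 2 ≤ N) (A B C : Fin n → Finset (ZMod N)),
          IsSTPP A B C ∧ (N : ℝ) < ∑ i, (((A i).card * (B i).card * (C i).card : ℕ) : ℝ) ^ τ := by
  rw [automaticPackingThesis_iff_cyclicBeat]
  constructor
  · intro h τ hτ
    obtain ⟨p, K, n, hp, A, B, C, hS, hbeat⟩ := h τ hτ
    rcases Nat.eq_zero_or_pos K with hK | hK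
    · -- `K = 0`: nothing beats the trivial group `ZMod 1`
      subst hK
      exfalso
      obtain ⟨A', B', C', hS', hcard⟩ := isSTPP_transport_eq (pow_zero p) hS
      have hle := sum_rpow_le_one_of_isSTPP_zmod_one A' B' C' hS' (show (0 : ℝ) < τ by linarith)
      have hsum : ∑ i, (((A' i).card * (B' i).card * (C' i).card : ℕ) : ℝ) ^ τ =
          ∑ i, (((A i).card * (B i).card * (C i).card : ℕ) : ℝ) ^ τ :=
        Finset.sum_congr rfl fun i _ => by rw [(hcard i).1, (hcard i).2.1, (hcard i).2.2]
      rw [hsum] at hle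
      rw [pow_zero] at hbeat
      exact absurd (hbeat.trans_le hle) (lt_irrefl _)
    · refine ⟨p ^ K, n, ?_, A, B, C, hS, by exact_mod_cast hbeat⟩
      calc 2 ≤ p := hp
        _ = p ^ 1 := (pow_one p).symm
        _ ≤ p ^ K := Nat.pow_le_pow_right (by omega) hK
  · intro h τ hτ
    obtain ⟨N, n, hN, A, B, C, hS, hbeat⟩ := h τ hτ
    obtain ⟨A', B', C', hS', hcard⟩ := isSTPP_transport_eq (pow_one N).symm hS
    refine ⟨N, 1, n, hN, A', B', C', hS', ?_⟩
    have hsum : ∑ i, (((A' i).card * (B' i).card * (C' i).card : ℕ) : ℝ) ^ τ =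
        ∑ i, (((A i).card * (B i).card * (C i).card : ℕ) : ℝ) ^ τ :=
      Finset.sum_congr rfl fun i _ => by rw [(hcard i).1, (hcard i).2.1, (hcard i).2.2]
    rw [hsum]
    push_cast
    simpa using hbeat

/-- **Refutation normal form.** The crux FAILS iff some exponent `τ₀ > 2/3` is a uniform packing
ceiling for cyclic STPP designs: `∑ᵢ (|Aᵢ||Bᵢ||Cᵢ|)^τ₀ ≤ N` for every STPP design in every `ℤ/N`,
`N ≥ 2`. [folklore] -/
theorem not_automaticPackingThesis_iff_uniformGap :
    ¬ AutomaticPackingThesis ↔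
      ∃ τ₀ : ℝ, 2 / 3 < τ₀ ∧ ∀ (N n : ℕ), 2 ≤ N → ∀ (A B C : Fin n → Finset (ZMod N)),
        IsSTPP A B C → ∑ i, (((A i).card * (B i).card * (C i).card : ℕ) : ℝ) ^ τ₀ ≤ (N : ℝ) := by
  rw [automaticPackingThesis_iff_anyModulus]
  constructor
  · intro h
    push Not at h
    obtain ⟨τ₀, hτ₀, hall⟩ := h
    exact ⟨τ₀, hτ₀, fun N n hN A B C hS => hall N n hN A B C hS⟩
  · rintro ⟨τ₀, hτ₀, hall⟩ h
    obtain ⟨N, n, hN, A, B, C, hS, hbeat⟩ := h τ₀ hτ₀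
    exact absurd (hbeat.trans_le (hall N n hN A B C hS)) (lt_irrefl _)

/-- **Monotonicity of the ceiling.** A uniform packing ceiling at `τ₀` is one at every smaller
positive exponent: block masses are naturals, so each term `x^τ` is monotone in `τ`. Hence the set of
exponents at which cyclic designs can beat their hosts is an up-set, and the crux is the statement
that its infimum is `2/3`. [folklore] -/
theorem uniformGap_mono {τ τ₀ : ℝ} (hτ : 0 < τ) (hle : τ ≤ τ₀)
    (hall : ∀ (N n : ℕ), 2 ≤ N → ∀ (A B C : Fin n → Finset (ZMod N)),
      IsSTPP A B C → ∑ i, (((A i).card * (B i).card * (C i).card : ℕ) : ℝ) ^ τ₀ ≤ (N : ℝ)) :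
    ∀ (N n : ℕ), 2 ≤ N → ∀ (A B C : Fin n → Finset (ZMod N)),
      IsSTPP A B C → ∑ i, (((A i).card * (B i).card * (C i).card : ℕ) : ℝ) ^ τ ≤ (N : ℝ) := by
  intro N n hN A B C hS
  refine le_trans (Finset.sum_le_sum fun i _ => ?_) (hall N n hN A B C hS)
  rcases Nat.eq_zero_or_pos ((A i).card * (B i).card * (C i).card) with hz | hpos
  · rw [hz, Nat.cast_zero, Real.zero_rpow hτ.ne', Real.zero_rpow (by linarith)]
  · exact Real.rpow_le_rpow_of_exponent_le (by exact_mod_cast hpos) hle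

/-- Registered stub `stub_normalForm` of crux stmt-MatrixMultiplication-7356 (line `Sketch`): the crux is
equivalent to its finite cyclic normal form — verbatim `automaticPackingThesis_iff_cyclicBeat`.
[folklore] -/
theorem stub_normalForm :
    Summit.MatrixMultiplication.MatrixMultiplication.Theses.AutomaticSTPPDesigns.AutomaticPackingThesis ↔
      ∀ τ : ℝ, 2 / 3 < τ → ∃ (p K n : ℕ) (_ : 2 ≤ p) (A B C : Fin n → Finset (ZMod (p ^ K))),
        Literature.Computability.AlgebraicComplexity.IsSTPP A B C ∧
          (p : ℝ) ^ K < ∑ i, (((A i).card * (B i).card * (C i).card : ℕ) : ℝ) ^ τ :=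
  automaticPackingThesis_iff_cyclicBeat

end AutomaticPackingThesis

end Summit.MatrixMultiplication.MatrixMultiplication.Theorems

end
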